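import Literature.AlgebraicGeometry.Motives.HodgeLieWeightOnePlusLineIdeal
import Literature.AlgebraicGeometry.Motives.HodgeLieComplexCenter
import Literature.AlgebraicGeometry.Motives.HodgeLieRealPlacesSl2
import Literature.AlgebraicGeometry.Motives.HodgeStructureEndAlgSemisimple
import Literature.AlgebraicGeometry.Motives.HodgeStructureK3TypeAdjointProofs
import Literature.LinearAlgebra.Matrix.ClassicalLieAlgebrasDimension
import Mathlib.LinearAlgebra.Matrix.BilinearForm
import HarnessLib

/-!
# Weight one, plus-line position: a `ψ`-SYMMETRIC anticommuting Hodge partner bounds the compact factor,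
# `dim 𝔨 ≤ C(d/4, 2)` — so `dim Lie Hg = 6` forces `dim_ℚ V ≥ 12`

Family `hodge`, layer `Literature/AlgebraicGeometry/Motives`; THEOREMS ONLY (no definition, no named fact; D-0026).
Sequel of `HodgeLieWeightOnePlusLineIdeal` for the cell `pub-hodgecm2` (COR-CM) lane MT-RANK-SEVEN (type II versus type III),
seat `b27`.

SETTING.  `H` polarized by `ψ`, weight `1`, graded basis `e` (degrees in `{0,1}`), Hodge projector `P = gradingEnd e deg`
(onto `F¹ = V^{1,0}`), a rational `X ∈ 𝔥 ∖ End_Hdg` in the plus-line position with blocks `E = P X_ℂ (1 − P)`,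
`F = (1 − P) X_ℂ P`, `E F = αP`, `F E = α(1 − P)`, `α ≠ 0` (`𝔷 = 0`); `𝔨 = {K ∈ 𝔥_ℂ : KP = PK, KE = EK}` the compact
factor, `dim 𝔨 + 3 = dim 𝔥` (`finrank_centraliser_add_three`).  NEW DATUM: Hodge endomorphisms `i, j ∈ End_Hdg(V)` with
`i² = a ≠ 0`, `j² = b ≠ 0`, `ij = −ji`, and `j` SYMMETRIC for `ψ` (`j† = j`) — the shape of the Rosati involution
`x ↦ u⁻¹ x̄ u` of a totally INDEFINITE quaternion algebra (Albert type II; Lange Thm. 2.6.5 (b)), as opposed to the canonical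
involution of type III where `i, j` are both skew.

RESULT **`exists_finrank_eq_four_mul_and_le_of_plusLine_of_symm_pair`**: `dim_ℚ V = 4r` and **`2 · dim Lie Hg ≤ r(r − 1) + 6`**,
i.e. `dim_ℂ 𝔨 ≤ C(r, 2) = dim 𝔰𝔬(r)`.  PROOF (no representation theory).  Let `μ² = b`, `Q = ½(1 + μ⁻¹ j_ℂ)` (an idempotent
commuting with `P, E, F` and all of `𝔥_ℂ`, `ψ_ℂ`-symmetric, with `i_ℂ (1 − Q) = Q i_ℂ`), `W = Q P V_ℂ = V^{1,0} ∩ ker(j_ℂ − μ)`;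
`4 · dim W = d` (`tr(QP) = ½ tr P` as `tr(j_ℂ P) = 0` by conjugating with `i_ℂ`, and `2 tr P = d`).  The symmetric form
`β(u, u′) = ψ_ℂ(u, F u′)` on `V^{1,0}` is `𝔨`-invariant, so `k ↦ c_k`, `c_k(m, m′) = ψ_ℂ(m, F k m′)` maps `𝔨` linearly to
the ANTISYMMETRIC bilinear forms on `W` (dimension `C(r, 2)`, the tree's `finrank_so` in a basis).  It is injective: `c_k = 0`
forces `k W = 0` (`W ⊥_β (1 − Q)V^{1,0}` as `Q` is `β`-symmetric, `V^{1,0}` is `ψ_ℂ`-isotropic, `V^{0,1} = F V^{1,0}`, and `ψ_ℂ`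
is non-degenerate), then `k (1 − Q)P V = i_ℂ k W′ = 0` (`i_ℂ` swaps the two `j_ℂ`-eigenspaces and commutes with `k`) and
`k (1 − P) V = α⁻¹ F k E V = 0`.  CONSEQUENCE (drawn in `CorCM/MumfordTateRankSevenQuaternionDefinite`): a simple abelian FOURFOLD
with totally indefinite quaternion multiplication over `ℚ` (`d = 8`, `r = 2`) cannot have `dim Lie Hg(H¹B) = 6`, i.e.
`dim MT(H¹B) ≠ 7`: at Mumford–Tate rank `7` a quaternion algebra `End⁰B` over `ℚ` is DEFINITE (Moonen–Zarhin Thm. (0.1) (2) vs (4)).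

* `finrank_le_choose_two_of_forall_antisymm` — pure linear algebra: a space mapping injectively and linearly into the
  antisymmetric bilinear forms on an `r`-dimensional space has dimension `≤ C(r, 2)`.
* **`exists_finrank_eq_four_mul_and_le_of_plusLine_of_symm_pair`** — the theorem above.

## References

* [MoonenZarhin1999LowDim] B. Moonen, Yu. Zarhin, *Hodge classes on abelian varieties of low dimension*, Math. Ann. 315
  (1999), Thm. (0.1) (2), (4), §2 (2.3) (type III: `Hg ∼ SL₂(ℝ) × SU(2)`; type II: `Hg = Sp_D(V, φ)`).
* [Lange2023AbelianVarietiesComplex] H. Lange, *Abelian Varieties over the Complex Numbers* (2023), §2.6.2 Thm. 2.6.5 (b)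
  (the Rosati involution `x ↦ a⁻¹ x̄ a` of a totally indefinite quaternion algebra).
* [BrockerTomDieck1985] Th. Bröcker, T. tom Dieck, *Representations of Compact Lie Groups*, GTM 98 (1985), I (2.15)
  (`dim so(n) = ½n(n − 1)`).
-/

noncomputable section

open scoped TensorProduct

namespace Literature.AlgebraicGeometry.Motives

universe u

namespace HodgeStructure

open ProjectorBlocks Literature.RepresentationTheory.GeneralLinear

/-! ## §1 Linear algebra: a space of antisymmetric forms on an `r`-dimensional space has dimension `≤ C(r, 2)` -/

/-- **A space mapping injectively and linearly into the antisymmetric bilinear forms on an `r`-dimensional space has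
dimension `≤ C(r, 2)`**: in a basis the antisymmetric forms are the antisymmetric matrices `so(r)`, of dimension `C(r, 2)`
(the tree's `Literature.LinearAlgebra.Matrix.finrank_so`). [cite: BrockerTomDieck1985, I (2.15) (p0023)] -/
theorem finrank_le_choose_two_of_forall_antisymm {K : Type*} [Field K] [NeZero (2 : K)] {M W : Type*}
    [AddCommGroup M] [Module K M] [AddCommGroup W] [Module K W] [FiniteDimensional K W]
    (c : M →ₗ[K] LinearMap.BilinForm K W) (hc : Function.Injective c) (hanti : ∀ k x y, c k x y = -c k y x) :
    Module.finrank K M ≤ (Module.finrank K W).choose 2 := by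
  classical
  letI : LieRing (Matrix (Fin (Module.finrank K W)) (Fin (Module.finrank K W)) K) := LieRing.ofAssociativeRing
  let b := Module.finBasis K W
  let T : LinearMap.BilinForm K W ≃ₗ[K] Matrix (Fin (Module.finrank K W)) (Fin (Module.finrank K W)) K :=
    LinearMap.BilinForm.toMatrix b
  have hmem : ∀ k, T (c k) ∈ (LieAlgebra.Orthogonal.so (Fin (Module.finrank K W)) K).toSubmodule := fun k => by
    rw [LieSubalgebra.mem_toSubmodule, LieAlgebra.Orthogonal.mem_so]
    ext x y
    rw [Matrix.transpose_apply, Matrix.neg_apply]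
    change LinearMap.BilinForm.toMatrix b (c k) y x = -LinearMap.BilinForm.toMatrix b (c k) x y
    rw [LinearMap.BilinForm.toMatrix_apply, LinearMap.BilinForm.toMatrix_apply, hanti]
  let f : M →ₗ[K] (LieAlgebra.Orthogonal.so (Fin (Module.finrank K W)) K).toSubmodule :=
    (T.toLinearMap ∘ₗ c).codRestrict _ hmem
  have hf : Function.Injective f := by
    intro k k' h
    have h' : T (c k) = T (c k') := congrArg Subtype.val h
    exact hc (T.injective h')
  calc Module.finrank K M
      ≤ Module.finrank K (LieAlgebra.Orthogonal.so (Fin (Module.finrank K W)) K).toSubmodule :=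
        LinearMap.finrank_le_finrank_of_injective hf
    _ = (Module.finrank K W).choose 2 := by
        have h := Literature.LinearAlgebra.Matrix.finrank_so (K := K) (m := Fin (Module.finrank K W))
        rw [Fintype.card_fin] at h
        exact h

/-! ## §2 The plus-line position with a `ψ`-symmetric anticommuting Hodge partner -/

variable {V : Type u} [AddCommGroup V] [Module ℚ V] [Module.Finite ℚ V] [HodgeTensorFacts.{u, u}] {n : ℤ}
  {S : Type u} [Fintype S] [DecidableEq S] {deg : S → ℤ}

omit [Module.Finite ℚ V] [HodgeTensorFacts.{u, u}] in
/-- Base change of a rational scalar: `(q · 1)_ℂ = q · 1`. [folklore] -/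
private theorem baseChange_algebraMap (q : ℚ) :
    (algebraMap ℚ (Module.End ℚ V) q).baseChange ℂ = (q : ℂ) • (1 : Module.End ℂ (ℂ ⊗[ℚ] V)) := by
  refine LinearMap.ext fun x => ?_
  induction x using TensorProduct.induction_on with
  | zero => rw [map_zero, map_zero]
  | tmul c v =>
    rw [LinearMap.baseChange_tmul, Algebra.algebraMap_eq_smul_one, LinearMap.smul_apply, Module.End.one_apply,
      TensorProduct.tmul_smul, LinearMap.smul_apply, Module.End.one_apply, ← algebraMap_smul ℂ q (c ⊗ₜ[ℚ] v),
      eq_ratCast]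
  | add x y hx hy => rw [map_add, map_add, hx, hy]

/-- **`dim_ℚ V = 4r` and `2 · dim Lie Hg ≤ r(r − 1) + 6`** in the plus-line position (weight one, `𝔷 = 0`, blocks
`E F = αP`, `F E = α(1 − P)`) when `End_Hdg(V)` contains an anticommuting pair `i² = a ≠ 0`, `j² = b ≠ 0` with `j`
SYMMETRIC for `ψ` (`j† = j`, the Rosati shape of a totally indefinite quaternion algebra): with `μ² = b`,
`Q = ½(1 + μ⁻¹ j_ℂ)` and `W = Q P V_ℂ` (`4 dim W = d`), the map `k ↦ ψ_ℂ(·, F k ·)|_W` embeds the compact factor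
`𝔨 = {K ∈ 𝔥_ℂ : KP = PK, KE = EK}` (of dimension `dim 𝔥 − 3`) into the antisymmetric forms on `W`, of dimension `C(r, 2)`.
For `d = 8` this gives `dim Lie Hg ≤ 4`: a simple abelian fourfold with indefinite quaternion multiplication over `ℚ` is
not at Mumford–Tate rank `7`. [cite: MoonenZarhin1999LowDim, Thm. (0.1) (2), (4) and §2 (2.3)]
[cite: Lange2023AbelianVarietiesComplex, §2.6.2 Thm. 2.6.5 (b)] -/
theorem exists_finrank_eq_four_mul_and_le_of_plusLine_of_symm_pair (H : HodgeStructure V n) (ψ : H.Polarization)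
    (hn : n = 1) (e : Module.Basis S ℂ (ℂ ⊗[ℚ] V)) (hF : ∀ a, H.F a = Submodule.span ℂ (e '' {σ | a ≤ deg σ}))
    (hFc : ∀ a, complexConj (H.F a) = Submodule.span ℂ (e '' {σ | deg σ ≤ n - a}))
    (hdeg : ∀ σ, deg σ = 0 ∨ deg σ = 1) {X : Module.End ℚ V} (hX : X ∈ H.hodgeLie) (hXE : X ∉ H.endAlg)
    (hplus : ∀ Y ∈ H.hodgeLieC, ∃ c : ℂ,
      gradingEnd e deg * Y * (1 - gradingEnd e deg) = c • (gradingEnd e deg * X.baseChange ℂ * (1 - gradingEnd e deg)))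
    (hminus : ∀ Y ∈ H.hodgeLieC, ∃ c : ℂ,
      (1 - gradingEnd e deg) * Y * gradingEnd e deg = c • ((1 - gradingEnd e deg) * X.baseChange ℂ * gradingEnd e deg))
    (hz : H.hodgeLie ⊓ Subalgebra.toSubmodule H.endAlg = ⊥)
    {i j : Module.End ℚ V} {a b : ℚ} (ha : a ≠ 0) (hb : b ≠ 0) (hi : i * i = algebraMap ℚ _ a)
    (hj : j * j = algebraMap ℚ _ b) (hij : i * j = -(j * i)) (hiA : i ∈ H.endAlg) (hjA : j ∈ H.endAlg)
    (hτj : ψ.adjoint j = j) :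
    ∃ r : ℕ, Module.finrank ℚ V = 4 * r ∧ 2 * Module.finrank ℚ H.hodgeLie ≤ r * (r - 1) + 6 := by
  classical
  subst hn
  obtain ⟨α, hα, hEF, hFE, -⟩ :=
    projE_mul_projF_eq_smul_of_plusLine_of_center_eq_bot H ψ rfl e hF hFc hdeg hX hXE hplus hminus hz
  have hPP : gradingEnd e deg * gradingEnd e deg = gradingEnd e deg := gradingEnd_mul_gradingEnd_of_deg e hdeg
  obtain ⟨hEM, hFM⟩ := projE_mem_hodgeLieC H e hF hFc hdeg (H.baseChange_mem_hodgeLieC hX)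
  have hΘM : (2 : ℂ) • gradingEnd e deg - 1 ∈ H.hodgeLieC := by
    have h := two_smul_gradingEnd_sub_mem_hodgeLieC H e hF hFc
    have h1 : ((1 : ℤ) : ℂ) • (1 : Module.End ℂ (ℂ ⊗[ℚ] V)) = 1 := by rw [Int.cast_one, one_smul]
    rw [h1] at h
    exact h
  have hk3 := finrank_centraliser_add_three H rfl e hF hFc hdeg hX hXE hplus hminus
  have hkF : ∀ Z : Module.End ℂ (ℂ ⊗[ℚ] V), Z * gradingEnd e deg = gradingEnd e deg * Z →
      Z * (gradingEnd e deg * X.baseChange ℂ * (1 - gradingEnd e deg)) =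
        (gradingEnd e deg * X.baseChange ℂ * (1 - gradingEnd e deg)) * Z →
      Z * ((1 - gradingEnd e deg) * X.baseChange ℂ * gradingEnd e deg) =
        ((1 - gradingEnd e deg) * X.baseChange ℂ * gradingEnd e deg) * Z := fun Z hZP hZE =>
    (commute_of_plusLine H ψ rfl e hF hFc hdeg hX hXE hplus hminus hz hZP hZE).1
  -- `range P ⊆ F¹` is `ψ_ℂ`-isotropic
  have hPF1 : ∀ z, gradingEnd e deg z ∈ H.F 1 := fun z => by
    rw [hF 1]
    exact Submodule.span_mono (Set.image_mono fun σ (h : deg σ = 1) => h.ge) (gradingEnd_apply_mem_span_one e hdeg z)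
  have h111 : (1 : ℤ) + 1 - 1 = 1 := by norm_num
  have hiso : ∀ z z', ψ.form.baseChange ℂ (gradingEnd e deg z) (gradingEnd e deg z') = 0 := fun z z' =>
    ψ.form_apply_eq_zero 1 _ (hPF1 z) _ (by rw [h111]; exact hPF1 z')
  set P := gradingEnd e deg with hP
  set E := P * X.baseChange ℂ * (1 - P) with hEdef
  set F := (1 - P) * X.baseChange ℂ * P with hFdef
  -- the compact factor `𝔨`
  set 𝔨 : Submodule ℂ (Module.End ℂ (ℂ ⊗[ℚ] V)) := H.hodgeLieC ⊓
    Module.End.eigenspace (LinearMap.mulLeft ℂ P - LinearMap.mulRight ℂ P) 0 ⊓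
    Module.End.eigenspace (LinearMap.mulLeft ℂ E - LinearMap.mulRight ℂ E) 0 with h𝔨
  have hmem : ∀ Z, Z ∈ 𝔨 ↔ Z ∈ H.hodgeLieC ∧ Z * P = P * Z ∧ Z * E = E * Z := fun Z => by
    rw [h𝔨, Submodule.mem_inf, Submodule.mem_inf, mem_eigenspace_adP_zero_iff, mem_eigenspace_adP_zero_iff]
    constructor
    · rintro ⟨⟨h1, h2⟩, h3⟩; exact ⟨h1, h2.symm, h3.symm⟩
    · rintro ⟨h1, h2, h3⟩; exact ⟨⟨h1, h2.symm⟩, h3.symm⟩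
  clear_value 𝔨
  have hPE : P * E = E := by rw [hEdef, ← mul_assoc, ← mul_assoc, hPP]
  clear_value E F
  clear_value P
  -- skewness and antisymmetry of `ψ_ℂ`
  have hswap : ∀ x y, ψ.form.baseChange ℂ y x = -ψ.form.baseChange ℂ x y :=
    form_baseChange_swap_of_odd H odd_one ψ
  have hskF : ∀ x y, ψ.form.baseChange ℂ x (F y) = -ψ.form.baseChange ℂ (F x) y := fun x y => by
    rw [formBaseChange_skew_of_mem_hodgeLieC ψ hFM, neg_neg]
  -- the complexified pair
  set ic := i.baseChange ℂ with hic
  set jc := j.baseChange ℂ with hjc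
  have ha' : (a : ℂ) ≠ 0 := by exact_mod_cast ha
  have hii : ic * ic = (a : ℂ) • (1 : Module.End ℂ (ℂ ⊗[ℚ] V)) := by
    rw [hic, ← LinearMap.baseChange_mul, hi, baseChange_algebraMap]
  have hjj : jc * jc = (b : ℂ) • (1 : Module.End ℂ (ℂ ⊗[ℚ] V)) := by
    rw [hjc, ← LinearMap.baseChange_mul, hj, baseChange_algebraMap]
  have hijc : ic * jc = -(jc * ic) := by
    rw [hic, hjc, ← LinearMap.baseChange_mul, hij, LinearMap.baseChange_neg, LinearMap.baseChange_mul]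
  have hsymj : ∀ x y, ψ.form.baseChange ℂ (jc x) y = ψ.form.baseChange ℂ x (jc y) := fun x y => by
    have h := ψ.form_baseChange_adjoint_left j x y
    rwa [hτj] at h
  -- Hodge endomorphisms commute with `𝔥_ℂ`, hence with `P`, `E`, `F`
  have hcommA : ∀ {g : Module.End ℚ V}, g ∈ H.endAlg → ∀ {Y : Module.End ℂ (ℂ ⊗[ℚ] V)}, Y ∈ H.hodgeLieC →
      Y * g.baseChange ℂ = g.baseChange ℂ * Y := fun hg _ hY => commute_baseChange_of_mem_hodgeLieC H hY ⟨_, hg⟩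
  have hΘiff : ∀ T : Module.End ℂ (ℂ ⊗[ℚ] V), ((2 : ℂ) • P - 1) * T = T * ((2 : ℂ) • P - 1) → P * T = T * P := by
    intro T h
    rw [sub_mul, mul_sub, one_mul, mul_one, sub_left_inj, smul_mul_assoc, mul_smul_comm] at h
    exact smul_right_injective _ (two_ne_zero (α := ℂ)) h
  have hjP : jc * P = P * jc := (hΘiff jc (hcommA hjA hΘM)).symm
  have hiP : ic * P = P * ic := (hΘiff ic (hcommA hiA hΘM)).symm
  have hjE : jc * E = E * jc := (hcommA hjA hEM).symm
  have hjF : jc * F = F * jc := (hcommA hjA hFM).symm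
  -- `μ² = b`, `Q = ½(1 + μ⁻¹ j_ℂ)`
  obtain ⟨μ, hμ⟩ := IsAlgClosed.exists_eq_mul_self ((b : ℚ) : ℂ)
  have hμ0 : μ ≠ 0 := by
    rintro rfl
    rw [mul_zero] at hμ
    exact hb (by exact_mod_cast hμ)
  obtain ⟨Q, hQ⟩ : ∃ Q : Module.End ℂ (ℂ ⊗[ℚ] V), Q = (2 : ℂ)⁻¹ • (1 + μ⁻¹ • jc) := ⟨_, rfl⟩
  have hhh : (μ⁻¹ • jc) * (μ⁻¹ • jc) = 1 := by
    rw [smul_mul_smul_comm, hjj, smul_smul, hμ, show μ⁻¹ * μ⁻¹ * (μ * μ) = 1 by field_simp, one_smul]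
  have hQQ : Q * Q = Q := by
    have hsq : (1 + μ⁻¹ • jc) * (1 + μ⁻¹ • jc) = (2 : ℂ) • (1 + μ⁻¹ • jc) := by
      rw [add_mul, one_mul, mul_add, mul_one, hhh, two_smul]
      abel
    rw [hQ, smul_mul_smul_comm, hsq, smul_smul]
    norm_num
  -- `Q` commutes with whatever commutes with `j_ℂ`
  have hQcomm : ∀ T : Module.End ℂ (ℂ ⊗[ℚ] V), jc * T = T * jc → Q * T = T * Q := fun T hT => by
    rw [hQ, smul_mul_assoc, mul_smul_comm, add_mul, mul_add, one_mul, mul_one, smul_mul_assoc, mul_smul_comm, hT]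
  have hQP : Q * P = P * Q := hQcomm P hjP
  have hQE : Q * E = E * Q := hQcomm E hjE
  have hQF : Q * F = F * Q := hQcomm F hjF
  have hQsym : ∀ x y, ψ.form.baseChange ℂ (Q x) y = ψ.form.baseChange ℂ x (Q y) := fun x y => by
    simp only [hQ, LinearMap.smul_apply, LinearMap.add_apply, Module.End.one_apply, map_add, map_smul, smul_eq_mul,
      hsymj]
  -- `i_ℂ Q = (1 − Q) i_ℂ`: `i_ℂ` swaps the two eigenspaces of `j_ℂ`
  have hiQ : ic * Q = (1 - Q) * ic := by
    have h1 : ic * jc = -(jc * ic) := hijc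
    rw [hQ]
    simp only [mul_smul_comm, mul_add, mul_one, sub_mul, one_mul, smul_mul_assoc, add_mul, h1]
    module
  -- `W = Q P V_ℂ`
  set W : Submodule ℂ (ℂ ⊗[ℚ] V) := LinearMap.range (Q * P) with hW
  have hWmem : ∀ {x : ℂ ⊗[ℚ] V}, x ∈ W → P x = x ∧ Q x = x := fun {x} hx => by
    obtain ⟨u, rfl⟩ := LinearMap.mem_range.1 hx
    refine ⟨?_, ?_⟩
    · rw [← Module.End.mul_apply, ← mul_assoc, ← hQP, mul_assoc, hPP]
    · rw [← Module.End.mul_apply, ← mul_assoc, hQQ]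
  -- `4 · dim W = d`
  have hrk : 4 * Module.finrank ℂ W = Module.finrank ℚ V := by
    have hidem : IsIdempotentElem (Q * P) := by
      change Q * P * (Q * P) = Q * P
      rw [mul_assoc, ← mul_assoc P Q P, ← hQP, mul_assoc, hPP, ← mul_assoc, hQQ]
    have htr := (LinearMap.IsIdempotentElem.isProj_range _ hidem).trace
    -- `tr(j_ℂ P) = 0` by conjugation with `i_ℂ`
    have hjtr : LinearMap.trace ℂ (ℂ ⊗[ℚ] V) (jc * P) = 0 := by
      have hinv' : ((a : ℂ)⁻¹ • ic) * ic = 1 := by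
        rw [smul_mul_assoc, hii, smul_smul, inv_mul_cancel₀ ha', one_smul]
      have hinv : ic * ((a : ℂ)⁻¹ • ic) = 1 := by
        rw [mul_smul_comm, hii, smul_smul, inv_mul_cancel₀ ha', one_smul]
      have h1 : LinearMap.trace ℂ (ℂ ⊗[ℚ] V) (ic * ((jc * P) * ((a : ℂ)⁻¹ • ic))) =
          LinearMap.trace ℂ (ℂ ⊗[ℚ] V) (jc * P) := by
        rw [LinearMap.trace_mul_comm, mul_assoc, hinv', mul_one]
      have hanti_ij : ic * jc + jc * ic = 0 := eq_neg_iff_add_eq_zero.1 hijc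
      have h2 : ic * ((jc * P) * ((a : ℂ)⁻¹ • ic)) = -(jc * P) := by
        rw [eq_neg_iff_add_eq_zero]
        calc ic * ((jc * P) * ((a : ℂ)⁻¹ • ic)) + jc * P
            = ic * ((jc * P) * ((a : ℂ)⁻¹ • ic)) + jc * P * (ic * ((a : ℂ)⁻¹ • ic)) := by rw [hinv, mul_one]
          _ = (ic * jc + jc * ic) * P * ((a : ℂ)⁻¹ • ic) := by
              simp only [← mul_assoc, add_mul]
              rw [mul_assoc jc P ic, ← hiP, ← mul_assoc]
          _ = 0 := by rw [hanti_ij, zero_mul, zero_mul]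
      rw [h2, map_neg] at h1
      have h3 : (2 : ℂ) * LinearMap.trace ℂ (ℂ ⊗[ℚ] V) (jc * P) = 0 := by
        rw [two_mul]
        nth_rw 1 [← h1]
        rw [neg_add_cancel]
      exact (mul_eq_zero.1 h3).resolve_left two_ne_zero
    have hd : 2 * LinearMap.trace ℂ (ℂ ⊗[ℚ] V) P = (Module.finrank ℚ V : ℂ) := by
      have h := (two_mul_trace_mul_proj (z := 1) hα hEF hFE (by rw [one_mul, mul_one])).1
      rw [one_mul, LinearMap.trace_one, Module.finrank_baseChange] at h
      exact h
    have h4 : (4 : ℂ) * LinearMap.trace ℂ (ℂ ⊗[ℚ] V) (Q * P) = (Module.finrank ℚ V : ℂ) := by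
      rw [hQ, smul_mul_assoc, add_mul, one_mul, smul_mul_assoc, map_smul, map_add, map_smul, hjtr, smul_zero, add_zero,
        smul_eq_mul, ← hd]
      ring
    rw [htr] at h4
    exact_mod_cast h4
  -- the map `k ↦ c_k`, `c_k(m, m′) = ψ_ℂ(m, F k m′)` on `W`
  obtain ⟨c, hc⟩ : ∃ c : Module.End ℂ (ℂ ⊗[ℚ] V) →ₗ[ℂ] LinearMap.BilinForm ℂ W,
      ∀ (k : Module.End ℂ (ℂ ⊗[ℚ] V)) (m m' : W),
        c k m m' = ψ.form.baseChange ℂ (m : ℂ ⊗[ℚ] V) (F (k (m' : ℂ ⊗[ℚ] V))) :=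
    ⟨{ toFun := fun k => (ψ.form.baseChange ℂ).comp W.subtype ((F * k) ∘ₗ W.subtype)
       map_add' := fun k k' => by
         refine LinearMap.ext fun m => LinearMap.ext fun m' => ?_
         simp only [LinearMap.BilinForm.comp_apply, LinearMap.add_apply, LinearMap.comp_apply, mul_add, map_add]
       map_smul' := fun t k => by
         refine LinearMap.ext fun m => LinearMap.ext fun m' => ?_
         simp only [LinearMap.BilinForm.comp_apply, LinearMap.smul_apply, LinearMap.comp_apply, mul_smul_comm, map_smul,
           RingHom.id_apply] },
      fun k m m' => by
        change (ψ.form.baseChange ℂ).comp W.subtype ((F * k) ∘ₗ W.subtype) m m' = _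
        rw [LinearMap.BilinForm.comp_apply]
        rfl⟩
  -- restricted to `𝔨`: antisymmetric values …
  have hanti : ∀ (k : 𝔨) (m m' : W),
      c (k : Module.End ℂ (ℂ ⊗[ℚ] V)) m m' = -c (k : Module.End ℂ (ℂ ⊗[ℚ] V)) m' m := by
    intro k m m'
    obtain ⟨hkM, hkP, hkE⟩ := (hmem k).1 k.2
    have hkF' := hkF k hkP hkE
    have hskk : ∀ x y, ψ.form.baseChange ℂ x ((k : Module.End ℂ (ℂ ⊗[ℚ] V)) y) =
        -ψ.form.baseChange ℂ ((k : Module.End ℂ (ℂ ⊗[ℚ] V)) x) y := fun x y => by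
      rw [formBaseChange_skew_of_mem_hodgeLieC ψ hkM, neg_neg]
    rw [hc, hc, hskF, hskk, neg_neg, ← Module.End.mul_apply, hkF', Module.End.mul_apply,
      hswap (F ((k : Module.End ℂ (ℂ ⊗[ℚ] V)) (m : ℂ ⊗[ℚ] V))) (m' : ℂ ⊗[ℚ] V), neg_neg]
  -- … and injective
  have hinj : ∀ k : 𝔨, c (k : Module.End ℂ (ℂ ⊗[ℚ] V)) = 0 → (k : Module.End ℂ (ℂ ⊗[ℚ] V)) = 0 := by
    intro k hk0
    obtain ⟨hkM, hkP, hkE⟩ := (hmem k).1 k.2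
    have hkF' := hkF k hkP hkE
    have hkj : (k : Module.End ℂ (ℂ ⊗[ℚ] V)) * jc = jc * k := hcommA hjA hkM
    have hki : (k : Module.End ℂ (ℂ ⊗[ℚ] V)) * ic = ic * k := hcommA hiA hkM
    have hkQ : Q * (k : Module.End ℂ (ℂ ⊗[ℚ] V)) = k * Q := hQcomm _ hkj.symm
    set kk := (k : Module.End ℂ (ℂ ⊗[ℚ] V)) with hkk
    -- Step 1: `k` kills `W`
    have hkW : ∀ u, kk ((Q * P) u) = 0 := by
      intro u
      -- `x = k Q P u ∈ W`
      have hxW : kk ((Q * P) u) ∈ W := by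
        refine ⟨kk u, ?_⟩
        rw [← Module.End.mul_apply, ← Module.End.mul_apply, mul_assoc Q P kk, ← hkP, ← mul_assoc, hkQ, mul_assoc]
      obtain ⟨hxP, hxQ⟩ := hWmem hxW
      set x := kk ((Q * P) u) with hx
      -- `ψ_ℂ(x, F m) = 0` for `m ∈ W`
      have horth : ∀ m ∈ W, ψ.form.baseChange ℂ x (F m) = 0 := by
        intro m hm
        have h0 := LinearMap.congr_fun₂ hk0 ⟨m, hm⟩ ⟨(Q * P) u, LinearMap.mem_range_self _ u⟩
        rw [hc] at h0
        change ψ.form.baseChange ℂ m (F x) = 0 at h0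
        rw [hskF, hswap, neg_neg] at h0
        exact h0
      refine ψ.eq_zero_of_forall_form_eq_zero fun y => ?_
      -- `y = P y + α⁻¹ F E (Q y) + α⁻¹ (1 − Q) F E y`
      have h1' : (1 - P) y = α⁻¹ • F (E y) := by
        rw [← Module.End.mul_apply, hFE, LinearMap.smul_apply, smul_smul, inv_mul_cancel₀ hα, one_smul]
      have hc' : F (E (Q y)) = Q (F (E y)) := by
        rw [← Module.End.mul_apply E Q, ← hQE, Module.End.mul_apply, ← Module.End.mul_apply F Q, ← hQF,
          Module.End.mul_apply]
      have hy : y = P y + (α⁻¹ • F (E (Q y)) + α⁻¹ • ((1 - Q) (F (E y)))) := by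
        rw [hc', ← smul_add, LinearMap.sub_apply, Module.End.one_apply, add_sub_cancel, ← h1', LinearMap.sub_apply,
          Module.End.one_apply, add_sub_cancel]
      have hQEy : E (Q y) ∈ W := ⟨E y, by
        rw [Module.End.mul_apply, ← Module.End.mul_apply P E, hPE, ← Module.End.mul_apply Q E, hQE, Module.End.mul_apply]⟩
      have h1 : ψ.form.baseChange ℂ x (P y) = 0 := by
        rw [← hxP]
        exact hiso x y
      have h3 : ψ.form.baseChange ℂ x ((1 - Q) (F (E y))) = 0 := by
        rw [← hxQ, hQsym, ← Module.End.mul_apply Q (1 - Q), mul_sub, mul_one, hQQ, sub_self, LinearMap.zero_apply,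
          map_zero]
      rw [hy, map_add, map_add, map_smul, map_smul, h1, horth _ hQEy, h3, smul_zero, zero_add, add_zero]
    -- Step 2: `k P = 0`
    have hkPv : ∀ v, kk (P v) = 0 := by
      intro v
      have hop : ic * (Q * P) * ic = (a : ℂ) • ((1 - Q) * P) := by
        rw [← mul_assoc ic Q P, hiQ, mul_assoc (1 - Q) ic P, hiP, ← mul_assoc, mul_assoc ((1 - Q) * P) ic ic, hii,
          mul_smul_comm, mul_one]
      have h1 : ic ((Q * P) (((a : ℂ)⁻¹) • ic v)) = (1 - Q) (P v) := by
        rw [map_smul, map_smul, ← Module.End.mul_apply ic (Q * P), ← Module.End.mul_apply (ic * (Q * P)) ic, hop,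
          LinearMap.smul_apply, smul_smul, inv_mul_cancel₀ ha', one_smul, Module.End.mul_apply]
      have hsplit : P v = (Q * P) v + ic ((Q * P) (((a : ℂ)⁻¹) • ic v)) := by
        rw [h1, Module.End.mul_apply, LinearMap.sub_apply, Module.End.one_apply, add_sub_cancel]
      rw [hsplit, map_add, hkW, zero_add, ← Module.End.mul_apply kk ic, hki, Module.End.mul_apply, hkW, map_zero]
    refine LinearMap.ext fun v => ?_
    have h1v : (1 - P) v = α⁻¹ • F (E v) := by
      rw [← Module.End.mul_apply, hFE, LinearMap.smul_apply, smul_smul, inv_mul_cancel₀ hα, one_smul]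
    have hv : v = P v + α⁻¹ • F (E v) := by
      rw [← h1v, LinearMap.sub_apply, Module.End.one_apply, add_sub_cancel]
    rw [LinearMap.zero_apply, hv, map_add, map_smul, hkPv, ← Module.End.mul_apply kk F, hkF', Module.End.mul_apply,
      ← hPE, Module.End.mul_apply, hkPv, map_zero, smul_zero, add_zero]
  -- dimension count
  clear_value W
  have hdim : Module.finrank ℂ 𝔨 ≤ (Module.finrank ℂ W).choose 2 := by
    have hanti' : ∀ (k : 𝔨) (x y : W), (c ∘ₗ 𝔨.subtype) k x y = -(c ∘ₗ 𝔨.subtype) k y x := fun k x y => by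
      rw [LinearMap.comp_apply, Submodule.subtype_apply]
      exact hanti k x y
    have hinj' : Function.Injective (c ∘ₗ 𝔨.subtype) := by
      intro k k' h
      rw [LinearMap.comp_apply, LinearMap.comp_apply, Submodule.subtype_apply, Submodule.subtype_apply] at h
      apply Subtype.ext
      have h' : c ((k : Module.End ℂ (ℂ ⊗[ℚ] V)) - k') = 0 := by
        rw [map_sub]
        exact sub_eq_zero.2 h
      exact sub_eq_zero.1 (hinj ⟨(k : Module.End ℂ (ℂ ⊗[ℚ] V)) - k', 𝔨.sub_mem k.2 k'.2⟩ h')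
    exact finrank_le_choose_two_of_forall_antisymm (K := ℂ) (M := ↥𝔨) (W := ↥W) (c ∘ₗ 𝔨.subtype) hinj' hanti'
  refine ⟨Module.finrank ℂ W, hrk.symm, ?_⟩
  have hch : (Module.finrank ℂ W).choose 2 * 2 = Module.finrank ℂ W * (Module.finrank ℂ W - 1) := by
    rw [Nat.choose_two_right, Nat.div_mul_cancel (Nat.even_mul_pred_self _).two_dvd]
  rw [← hch]
  omega

end HodgeStructure

end Literature.AlgebraicGeometry.Motives

end
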